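import Summits.BirchSwinnertonDyer.BirchSwinnertonDyer.Theorems.KatoDescentPotSupersingularKatoFiniteLevelCount
import Literature.NumberTheory.EllipticCurves.LocalKummerMap
import Literature.NumberTheory.EllipticCurves.WeilPairingProofs
import Literature.NumberTheory.GaloisCohomology.PoitouTateNumberField
import HarnessLib

/-!
# Kato's (14.9.3) / 14.16 at finite level, part 2: `#S(T) = #S(T*(1))` at level `n` (Prop. 14.16 (1)), the
# Weil data DISCHARGED, the local factors EVALUATED (`#𝓚_v = #E(K_v)[n] · #(𝓞_v/n)`), and the statement for
# THE canonical invariant maps modulo `SelmerComplement` alone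
# (route `KatoDescentPotSupersingular` / `…Tame…`, crux M = stmt-BirchSwinnertonDyer-19196; route-free helper)

Seat `bsd-potss-rkm` g17 (prover; cell `bsd-potss`), item stmt-BirchSwinnertonDyer-19196 `ReducibleKatoMember`
(`--supports … --as helper`; closes nothing).  HONEST FRAMING: BSD is not proved by any of this; nothing is booked;
theorems only (no definition, no named fact).  Sequel of `…KatoFiniteLevelCount` (`natCard_selmerGroup_relaxed_eq`:
`#H¹_ℛ(K, E[n]) = #H¹_𝓢(K, E[n]) · ∏_{v ∈ P} #𝓚_v` for Kato's strict / relaxed structures, unramified at every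
finite `v ∉ P` including the bad places).

## What

* §1 **`natCard_selmerGroup_kato_eq_dual` — Kato Prop. 14.16 (1) `#S(T) = #S(T*(1))` at finite level**: for Kato's
  own structure `𝓚'` on `E[n]` (`𝓚_v` = local Kummer condition at `v ∈ P`, UNRAMIFIED at every finite `v ∉ P`),
  `#H¹_{𝓚'}(K, E[n]) = #H¹_{𝓚'^*}(K, E[n]^D)` — from `IsPerfect` ALONE (no global duality): the Weil transport
  `θ : E[n] ⥲ E[n]^D` carries `H¹_{𝓚'}` isomorphically onto `H¹_{𝓚'^*}`, because `θ⁻¹(𝓚_v^*) = 𝓚_v` (Tate local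
  duality for `E`, n1011) and `θ⁻¹((H¹_ur)^*) = H¹_ur` at the possibly RAMIFIED finite `v ∉ P`
  (`…UnramifiedLocalConditionSelfDual`, rkm g17).  (Kato proves (1) on p. 245 by combining (14.9.3) and (14.9.4);
  at finite level it is literally an isomorphism of the two groups.)
* §2 **`natCard_selmerGroup_relaxed_eq_of_weilPairing`** — the count of part 1 with the Weil-pairing data
  DISCHARGED by the tree theorem `WeierstrassCurve.exists_weilPairing_holds` (Silverman III.8.1), and
  **`natCard_selmerGroup_relaxed_eq_eval`** — with the local factors evaluated by Milne I Lemma 3.3 (tree theorem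
  `WeierstrassCurve.natCard_kummerSelmerStructure_inr`): `#H¹_ℛ = #H¹_𝓢 · ∏_{v∈P} #E(K_v)[n] · #(𝓞_{K_v}/n)`.
  For `K = ℚ`, `P = {p}`, `n = p^k` this reads `#H¹_rel(ℚ, E[p^k]) = #H¹_str(ℚ, E[p^k]) · #E(ℚ_p)[p^k] · p^k` —
  the level-`p^k` shadow of Kato's count (14.16.1)–(14.16.3) (`#H²(ℚ_p,T) = #E(ℚ_p)[p^∞]`, `rank H¹(ℤ[1/p],T) = 1`).
* §3 **`natCard_selmerGroup_relaxed_eq_canonical`** — for a number field `K : Type` and THE invariant maps of class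
  field theory (`LocalInvariants.canonical K n`: `IsPerfect` = `canonical_isPerfect`, the reciprocity law
  `SumLocalTermEqZero` ⟸ `sumInvLocalizationEqZero_canonical_of_numberField`, both tree THEOREMS) the count holds
  modulo the SINGLE printed property `SelmerComplement` (Milne I Thm. 4.10(b) `Ker γ¹ ⊆ Im β¹` / Howard 2.1.11).

References: K. Kato, Astérisque 295 (2004) 14.8, (14.9.3)–(14.9.4), Prop. 14.16 (pp. 238–245) [Kato2004Asterisque];
J. S. Milne, *ADT* (2006) I Lemma 3.3, Cor. 3.4, Thm. 2.6, Thm. 4.10 [MilneADT2006]; J. H. Silverman, *AEC* III.8.1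
[SilvermanAEC2009].
-/

-- the summit and its single problem are both named `BirchSwinnertonDyer` (registry layout D-0017)
set_option linter.dupNamespace false
set_option autoImplicit false

noncomputable section

open scoped Classical ContRepresentation NumberField
open Function Field NumberField IsDedekindDomain WeierstrassCurve
open Literature.NumberTheory.EllipticCurves Literature.NumberTheory.GaloisRepresentations
  Literature.NumberTheory.GaloisRepresentations.DiscreteGaloisModule Literature.NumberTheory.GaloisCohomology
open Summit.BirchSwinnertonDyer.Rank1Residual.X11b.Levels Summit.BirchSwinnertonDyer.Rank1Residual.X11b.LocBridge
open Summit.BirchSwinnertonDyer.Rank1Residual.GaloisImage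

universe u

namespace Summit.BirchSwinnertonDyer.BirchSwinnertonDyer.Theorems.KatoFiniteLevelCount

section WeilData

variable {K : Type u} [Field K] [NumberField K] (W : WeierstrassCurve K) (n : ℕ) [NeZero n]
  [W.IsElliptic] [Finite (geomTorsion W n)]
variable (e : geomTorsion W n → geomTorsion W n → AlgebraicClosure K)
  (hμ : ∀ S T, e S T ^ n = 1)
  (hadd₁ : ∀ S₁ S₂ T, e (S₁ + S₂) T = e S₁ T * e S₂ T)
  (hadd₂ : ∀ S T₁ T₂, e S (T₁ + T₂) = e S T₁ * e S T₂)
  (hgal : ∀ (σ : absoluteGaloisGroup K) (S T : geomTorsion W n), σ • e S T = e (σ • S) (σ • T))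

/-! ## §1 Kato Prop. 14.16 (1) at finite level: `#H¹_{𝓚'}(K, E[n]) = #H¹_{𝓚'^*}(K, E[n]^D)` -/

include hμ hadd₁ hadd₂ hgal in
/-- **Kato, Prop. 14.16 (1) `#S(T) = #S(T*(1))`, at the finite level `E[n]`**: for Kato's structure `𝓚'` on
`E[n]` — the local Kummer condition `𝓚_v` at `v ∈ P ⊇ {v ∣ n}` and the UNRAMIFIED condition at every finite
`v ∉ P` (bad places included), with `T ⊇ P` a finite set containing the ramification — `#H¹_{𝓚'}(K, E[n]) =
#H¹_{𝓚'^*}(K, E[n]^D)`, for every PERFECT family at odd prime-power `n` (no global duality used): `θ_*` and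
`θ⁻¹_*` are mutually inverse bijections between the two groups since `θ⁻¹(𝓚_v^*) = 𝓚_v`
(`dualTransported_kummerSelmerStructure_inr`) and `θ⁻¹((H¹_ur)^*) = H¹_ur` at `v ∤ n`
(`dualTransported_eq_unramifiedSubgroup_of_apply_eq`). [cite: Kato2004Asterisque, Prop. 14.16 (1) (p. 244)]
[cite: MilneADT2006, Ch. I, Cor. 3.4 and Thm. 2.6] -/
theorem natCard_selmerGroup_kato_eq_dual
    (halt : ∀ T, e T T = 1) (hnondeg : ∀ T, (∀ S, e S T = 1) → T = 0) (hn : IsPrimePow n) (hodd : Odd n)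
    (inv : LocalInvariants K n) (hperf : inv.IsPerfect)
    (P T : Finset (HeightOneSpectrum (𝓞 K))) (hPT : P ⊆ T)
    (hP : ∀ v : HeightOneSpectrum (𝓞 K), ((n : ℕ) : 𝓞 K) ∈ v.asIdeal → v ∈ P)
    (hT : ∀ v : HeightOneSpectrum (𝓞 K), v ∉ T → GaloisRep.IsUnramifiedAt v (W.torsionGaloisModule n))
    (𝓕 : SelmerStructure (W.torsionGaloisModule n))
    (h𝓕P : ∀ v ∈ P, 𝓕 (Sum.inr v) = W.kummerSelmerStructure n (Sum.inr v))
    (h𝓕ur : ∀ v ∉ P, 𝓕 (Sum.inr v) = unramifiedSubgroup (GaloisRep.toLocal v (W.torsionGaloisModule n)) 1) :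
    Nat.card 𝓕.selmerGroup = Nat.card (inv.dualSelmerStructure (W.torsionGaloisModule n) 𝓕).selmerGroup := by
  have hnotP : ∀ v : HeightOneSpectrum (𝓞 K), v ∉ P → ((n : ℕ) : 𝓞 K) ∉ v.asIdeal :=
    fun v hv h => hv (hP v h)
  haveI : Finite 𝓕.selmerGroup :=
    SelmerFinite.finite_selmerGroup_of_unramified_outside (W.torsionGaloisModule n) (S := (↑T : Set _))
      T.finite_toSet (fun v hv => hT v hv) fun v hv => h𝓕ur v (fun h => hv (hPT h))
  have hEP : ∀ v : HeightOneSpectrum (𝓞 K), localEulerPoincareCharacteristic (v.adicCompletion K) :=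
    fun v => by
      haveI : CharZero (v.adicCompletion K) := charZero_adicCompletion v
      exact localEulerPoincareCharacteristic_holds (v.adicCompletion K)
  refine natCard_selmerGroup_eq_natCard_dualSelmerGroup_of_dualTransported W n e hμ hadd₁ hadd₂ hgal hnondeg
    hodd inv 𝓕 𝓕 fun v => ?_
  by_cases hv : v ∈ P
  · have h := dualTransported_kummerSelmerStructure_inr W n e hμ hadd₁ hadd₂ hgal halt hnondeg hn v (hEP v)
      inv (hperf v).1.1
    rw [h𝓕P v hv, ← h]
    ext x
    simp only [LocalInvariants.mem_dualTransported_iff, LocalInvariants.dualSelmerStructure_apply, h𝓕P v hv]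
  · rw [h𝓕ur v hv]
    exact dualTransported_eq_unramifiedSubgroup_of_apply_eq W n e hμ hadd₁ hadd₂ hgal hnondeg hn inv hperf 𝓕 v
      (hnotP v hv) (h𝓕ur v hv)

end WeilData

/-! ## §2 The Weil data discharged; the local factors evaluated -/

section Discharged

variable {K : Type u} [Field K] [NumberField K] (W : WeierstrassCurve K) (n : ℕ) [NeZero n] [W.IsElliptic]

/-- **`#H¹_ℛ(K, E[n]) = #H¹_𝓢(K, E[n]) · ∏_{v ∈ P} #𝓚_v` with the Weil-pairing data DISCHARGED** (the tree
theorem `WeierstrassCurve.exists_weilPairing_holds`: a bilinear, alternating, non-degenerate, Galois-equivariant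
`eₙ` on `E[n]` with values in `μₙ`; number fields are perfect and `n ≠ 0` in `K`).  Hypotheses as in
`natCard_selmerGroup_relaxed_eq`. [cite: Kato2004Asterisque, (14.9.3) (p. 240) and Prop. 14.16 (p. 244)]
[cite: SilvermanAEC2009, III.8.1] -/
theorem natCard_selmerGroup_relaxed_eq_of_weilPairing (hn : IsPrimePow n) (hodd : Odd n)
    (inv : LocalInvariants K n) (hperf : inv.IsPerfect) (hsum : inv.SumLocalTermEqZero)
    (hcompl : inv.SelmerComplement)
    (P T : Finset (HeightOneSpectrum (𝓞 K))) (hPT : P ⊆ T)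
    (hP : ∀ v : HeightOneSpectrum (𝓞 K), ((n : ℕ) : 𝓞 K) ∈ v.asIdeal → v ∈ P)
    (hT : ∀ v : HeightOneSpectrum (𝓞 K), v ∉ T → GaloisRep.IsUnramifiedAt v (W.torsionGaloisModule n))
    (𝓢 ℛ : SelmerStructure (W.torsionGaloisModule n))
    (h𝓢P : ∀ v ∈ P, 𝓢 (Sum.inr v) = ⊥) (hℛP : ∀ v ∈ P, ℛ (Sum.inr v) = ⊤)
    (h𝓢ur : ∀ v ∉ P, 𝓢 (Sum.inr v) = unramifiedSubgroup (GaloisRep.toLocal v (W.torsionGaloisModule n)) 1)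
    (hℛur : ∀ v ∉ P, ℛ (Sum.inr v) = unramifiedSubgroup (GaloisRep.toLocal v (W.torsionGaloisModule n)) 1) :
    Nat.card ℛ.selmerGroup =
      Nat.card 𝓢.selmerGroup * ∏ v ∈ P, Nat.card (W.kummerSelmerStructure n (Sum.inr v)) := by
  haveI : Finite (geomTorsion W n) := finite_geomTorsion_of_neZero W n
  have hnK : (n : K) ≠ 0 := Nat.cast_ne_zero.2 (NeZero.ne n)
  obtain ⟨e, hμ, hadd₁, hadd₂, halt, hnondeg, hgal⟩ := exists_weilPairing_holds W n hn.two_le hnK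
  exact natCard_selmerGroup_relaxed_eq W n e hμ hadd₁ hadd₂ hgal halt hnondeg hn hodd inv hperf hsum hcompl P T
    hPT hP hT 𝓢 ℛ h𝓢P hℛP h𝓢ur hℛur

/-- **The count with the local factors EVALUATED**: `#H¹_ℛ(K, E[n]) = #H¹_𝓢(K, E[n]) · ∏_{v ∈ P} (#E(K_v)[n] ·
#(𝓞_{K_v}/n𝓞_{K_v}))` — Milne I Lemma 3.3 `#E(K_v)/nE(K_v) = #E(K_v)[n] · #(𝓞_v/n)` for the local Kummer
condition (tree theorem `WeierstrassCurve.natCard_kummerSelmerStructure_inr`).  Over `K = ℚ` with `P = {p}`,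
`n = p^k`: `#H¹_rel(ℚ, E[p^k]) = #H¹_str(ℚ, E[p^k]) · #E(ℚ_p)[p^k] · p^k`, the level-`p^k` shadow of
`[H¹(ℤ[1/p],T) : tors] ~ p^k` (rank one, Thm. 14.5 (1)) times `#H²(ℚ_p, T) = #E(ℚ_p)[p^∞]` of (14.16.1).
[cite: Kato2004Asterisque, Prop. 14.16 proof, (14.16.1)–(14.16.3) (p. 245)] [cite: MilneADT2006, Ch. I, Lemma 3.3] -/
theorem natCard_selmerGroup_relaxed_eq_eval (hn : IsPrimePow n) (hodd : Odd n)
    (inv : LocalInvariants K n) (hperf : inv.IsPerfect) (hsum : inv.SumLocalTermEqZero)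
    (hcompl : inv.SelmerComplement)
    (P T : Finset (HeightOneSpectrum (𝓞 K))) (hPT : P ⊆ T)
    (hP : ∀ v : HeightOneSpectrum (𝓞 K), ((n : ℕ) : 𝓞 K) ∈ v.asIdeal → v ∈ P)
    (hT : ∀ v : HeightOneSpectrum (𝓞 K), v ∉ T → GaloisRep.IsUnramifiedAt v (W.torsionGaloisModule n))
    (𝓢 ℛ : SelmerStructure (W.torsionGaloisModule n))
    (h𝓢P : ∀ v ∈ P, 𝓢 (Sum.inr v) = ⊥) (hℛP : ∀ v ∈ P, ℛ (Sum.inr v) = ⊤)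
    (h𝓢ur : ∀ v ∉ P, 𝓢 (Sum.inr v) = unramifiedSubgroup (GaloisRep.toLocal v (W.torsionGaloisModule n)) 1)
    (hℛur : ∀ v ∉ P, ℛ (Sum.inr v) = unramifiedSubgroup (GaloisRep.toLocal v (W.torsionGaloisModule n)) 1) :
    Nat.card ℛ.selmerGroup =
      Nat.card 𝓢.selmerGroup * ∏ v ∈ P,
        (Nat.card (nsmulAddMonoidHom n : (W.baseChange (v.adicCompletion K)).toAffine.Point →+ _).ker *
          Nat.card (v.adicCompletionIntegers K ⧸ Ideal.span {(n : v.adicCompletionIntegers K)})) := by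
  rw [natCard_selmerGroup_relaxed_eq_of_weilPairing W n hn hodd inv hperf hsum hcompl P T hPT hP hT 𝓢 ℛ h𝓢P hℛP
    h𝓢ur hℛur]
  congr 1
  exact Finset.prod_congr rfl fun v _ => W.natCard_kummerSelmerStructure_inr v (NeZero.ne n)

end Discharged

/-! ## §3 THE canonical invariant maps: the count modulo `SelmerComplement` alone -/

section Canonical

variable {K : Type} [Field K] [NumberField K] (W : WeierstrassCurve K) (n : ℕ) [NeZero n] [W.IsElliptic]

/-- **Kato's (14.9.3) at finite level for THE invariant maps of class field theory**: for a number field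
`K : Type`, an odd prime power `n`, finite sets `P ⊆ T` of finite places with `P ⊇ {v ∣ n}`, `T ⊇` the
ramification of `E[n]`, and Kato's strict / relaxed structures `𝓢`, `ℛ` (zero / everything at `P`, UNRAMIFIED
at every finite `v ∉ P`): `#H¹_ℛ(K, E[n]) = #H¹_𝓢(K, E[n]) · ∏_{v∈P} #𝓚_v` GRANTED ONLY `SelmerComplement` for
`LocalInvariants.canonical K n` (Milne I 4.10(b) `⊇` / Howard Thm. 2.1.11; the other Poitou–Tate inputs —
local Tate duality `canonical_isPerfect`, the reciprocity law `sumInvLocalizationEqZero_canonical_of_numberField`,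
Milne I 2.6 in its ramified form, Tate's local Euler characteristic, Tate local duality for `E`, the Weil pairing —
are tree theorems). [cite: Kato2004Asterisque, (14.9.3) (p. 240) and Prop. 14.16 (p. 244)]
[cite: MilneADT2006, Ch. I, Thm. 4.10] -/
theorem natCard_selmerGroup_relaxed_eq_canonical (hn : IsPrimePow n) (hodd : Odd n)
    (hSC : (LocalInvariants.canonical K n).SelmerComplement)
    (P T : Finset (HeightOneSpectrum (𝓞 K))) (hPT : P ⊆ T)
    (hP : ∀ v : HeightOneSpectrum (𝓞 K), ((n : ℕ) : 𝓞 K) ∈ v.asIdeal → v ∈ P)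
    (hT : ∀ v : HeightOneSpectrum (𝓞 K), v ∉ T → GaloisRep.IsUnramifiedAt v (W.torsionGaloisModule n))
    (𝓢 ℛ : SelmerStructure (W.torsionGaloisModule n))
    (h𝓢P : ∀ v ∈ P, 𝓢 (Sum.inr v) = ⊥) (hℛP : ∀ v ∈ P, ℛ (Sum.inr v) = ⊤)
    (h𝓢ur : ∀ v ∉ P, 𝓢 (Sum.inr v) = unramifiedSubgroup (GaloisRep.toLocal v (W.torsionGaloisModule n)) 1)
    (hℛur : ∀ v ∉ P, ℛ (Sum.inr v) = unramifiedSubgroup (GaloisRep.toLocal v (W.torsionGaloisModule n)) 1) :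
    Nat.card ℛ.selmerGroup =
      Nat.card 𝓢.selmerGroup * ∏ v ∈ P, Nat.card (W.kummerSelmerStructure n (Sum.inr v)) :=
  natCard_selmerGroup_relaxed_eq_of_weilPairing W n hn hodd (LocalInvariants.canonical K n)
    LocalInvariants.canonical_isPerfect
    ((LocalInvariants.canonical K n).sumLocalTermEqZero_of_sumInvLocalizationEqZero
      (sumInvLocalizationEqZero_canonical_of_numberField K n))
    hSC P T hPT hP hT 𝓢 ℛ h𝓢P hℛP h𝓢ur hℛur

end Canonical

end Summit.BirchSwinnertonDyer.BirchSwinnertonDyer.Theorems.KatoFiniteLevelCount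

end
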